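import Summits.ResolutionOfSingularities.ResolutionOfSingularities.Theorems.HilbertSamuelEliminationSigmaMaxModificationsCorridor3WLadderIsoTransitionBirth
import Summits.ResolutionOfSingularities.ResolutionOfSingularities.Theorems.HilbertSamuelEliminationSigmaMaxModificationsCorridor3WLadderIsoStepBirth
import Summits.ResolutionOfSingularities.ResolutionOfSingularities.Theorems.HilbertSamuelEliminationSigmaMaxModificationsCorridor3RegularValue
import HarnessLib

/-!
# [OURS · L1 W4.2] D17 (i) CLOSED BY NAME: `IsoTransitionLaw3 p Q` holds for every `p` and every origin class `Q`

Crux chain w42 (`SigmaMaxModifications`, stmt-ResolutionOfSingularities-18506; conjunct `SigmaMaxModificationsCorridor3`,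
stmt-ResolutionOfSingularities-19249). Object D17 «ALT LAW» (res-L1-w42-plan-1 RULINGS v3.12-4 (V) / v3.13-3 (AM): hand res-L1-type-o1 for (i);
res-type-067 typed (ii) `NoRecurrentIsoPointBirth3` and proved (iii) `wtopAltM_of_noRecurrentIsoPointBirth3` modulo the named transition law
`IsoTransitionLaw3 p Q`, p517090 + p518912). This leaf DISCHARGES that law from the typer's def-free transition lemma
(`Moving.exists_isoStepBirth_along_chain`, `…Corridor3WLadderIsoStepBirth.lean` p519302):

* `Moving.isoTransitionLaw3_holds (p) (Q) : IsoTransitionLaw3 p Q` — UNCONDITIONAL (every prime or not, every `Q`, every functional admissible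
  oracle): at `ν ≠ Φ^{(3)}` the cycle-invariant lemma applies (H non-increase along the permissible blow-down, `ν` never exceeded, isolation
  ⇒ `U ∩ X_n(ν) = {x_n}`, irreducible density; non-triviality at the never-isolated `x_{n+1}` = stub-4's
  `CycleInv.exists_ne_of_mem_componentsThrough`); at the regular value `ν = Φ^{(3)}` there is no infinite chain of canonical near steps from a
  maximal origin at all (`IsMaximalOrigin.noNearChainFrom_of_eq_iterPSum`, …Corridor3RegularValue), so the law's chain hypotheses are absurd.
  The grade hypothesis `3 ≤ ē` of the law is not used.
* `Moving.wtopAltM_of_noRecurrentIsoPointBirth3' (hrec : NoRecurrentIsoPointBirth3 p Q) : WtopAltM p Q` — D17 (iii) with (i) discharged: the ALT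
  row of the pointed-row decomposition (RULINGS v3.12-4 (V), res-type-012's `WtopAltM` p-D16) now rests on the ONE conjecture-tagged OURS claim
  `NoRecurrentIsoPointBirth3 p Q` (res-type-067, p517090) and nothing else.

OURS (cell res-hironaka, slot W4.2); NOT a statement of H. Hironaka's manuscript [Hironaka2017] nor of [CossartJannsenSaito2020]; AI-written,
weaker than expert review. Helper file `--supports stmt-ResolutionOfSingularities-19249 --as helper` (counted 0); theorem-only.
-/

noncomputable section

set_option linter.dupNamespace false

open CategoryTheory AlgebraicGeometry TopologicalSpace Topology
open Summit.ResolutionOfSingularities.ResolutionOfSingularities.Theorems.CampaignW42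
open Literature.AlgebraicGeometry.Resolution Literature.RingTheory.HilbertSamuel
open Literature.AlgebraicGeometry.CossartJannsenSaito2020
open Summit.ResolutionOfSingularities.ResolutionOfSingularities.Theorems.SigmaMaxModificationsCorridor3
open Summit.ResolutionOfSingularities.ResolutionOfSingularities.Cruxes.SigmaMaxModifications.IdeasL1Idea2R4 (WtopAltM)

universe u

namespace Summit.ResolutionOfSingularities.ResolutionOfSingularities.Theorems.SigmaMaxModificationsCorridor3.Moving

/-- **D17 (i) CLOSED BY NAME — the iso → non-iso transition law holds**, for every `p` and every origin class `Q`: along a chain of canonical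
near steps from a maximal origin at level `3` (functional admissible oracle), if `x_n` is isolated in the Hilbert–Samuel locus and `x_{n+1}` is
not, the blow-down of the step carries an iso point birth through `x_{n+1}` (res-type-067's `IsIsoPointBirthAt`, p517090).
[cite: CossartJannsenSaito2020, Thm. 3.10 (1), Rem. 6.29 (1), Def. 13.3] -/
theorem isoTransitionLaw3_holds (p : ℕ) (Q : ℕ → (ℕ → ℕ) → ∀ X : Scheme.{u}, X → Prop) : IsoTransitionLaw3.{u} p Q := by
  intro R _hRf hRa ν X _ x hX _hQ c h0 hstep _hG n hiso hni
  by_cases hν : ν = iterPSum 3 Phi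
  · exact absurd ⟨c, h0, hstep, fun _ => trivial⟩ (hX.noNearChainFrom_of_eq_iterPSum hRa hν fun _ => True)
  · obtain ⟨f, hf⟩ := (hstep n).exists_stepProjection
    obtain ⟨Z', hZ', hcl, hnt⟩ := exists_isoStepBirth_along_chain hRa hν hX h0 hstep hiso hni hf
    exact ⟨f, hf, Z', hiso, hZ', hcl, hnt.ne_singleton⟩

/-- **D17 (iii) WITH (i) DISCHARGED**: `WtopAltM p Q` — no alternating (isolated i.o. AND non-isolated i.o.) moving W-top chain from a
`Q`-maximal origin — follows from the single conjecture-tagged OURS row `NoRecurrentIsoPointBirth3 p Q` (res-type-067 p517090; its closer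
`wtopAltM_of_noRecurrentIsoPointBirth3` p518912 composed with `isoTransitionLaw3_holds`). [folklore] -/
theorem wtopAltM_of_noRecurrentIsoPointBirth3' {p : ℕ} {Q : ℕ → (ℕ → ℕ) → ∀ X : Scheme.{u}, X → Prop}
    (hrec : NoRecurrentIsoPointBirth3 p Q) : WtopAltM.{u} p Q :=
  wtopAltM_of_noRecurrentIsoPointBirth3 (isoTransitionLaw3_holds p Q) hrec

end Summit.ResolutionOfSingularities.ResolutionOfSingularities.Theorems.SigmaMaxModificationsCorridor3.Moving

end
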